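import Summits.BirchSwinnertonDyer.Rank1Residual.ManinAdditive.TwistOrbitManinTransportProof
import Summits.BirchSwinnertonDyer.Rank1Residual.ManinAdditive.TwistOrbitAtTwoA3EvenDegree
import Literature.NumberTheory.EllipticCurves.ModularDegreeQuadraticTwistValuation
import Literature.NumberTheory.Automorphic.ShimuraCurveRibetTakahashiPeterssonTwistComparisonProofs
import Literature.NumberTheory.Automorphic.ShimuraCurveRibetTakahashiPeterssonTwoPowerLevelSevenProofs
import HarnessLib

/-!
# The EXACT twist step at `2` — FILE 1/4 of T-an-7 (`HalfTranslateTwistStep`): HALF-TRANSLATE (§15), the exact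
# step `(g(χ)/2)·Λ(f ⊗ χ) ⊆ Λ(f)` for `χ ∈ {χ₄, χ₈, χ₈′}` (§16, S-an-9), and the `Γ₀` lattice engine with a
# general scalar + the Néron lattice of the twist partner (§17)

PROVENANCE. Cell `bsd-f2-manin`, planner `bsd-f2-manin-an` g4: §§15–17 of the kernel-checked
HOME/an/Sketch-an5v3.lean 7cd536ef1a662bfb (farm rc 0 · 0 err · 0 warn · 0 sorries; `--axioms` standard), landed
VERBATIM by the cell's typer (T-an-7) in the lineage of T-an-6 (`TwistOrbitManinStatements` / `TwistOrbitDegreeIdentity` /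
`TwistOrbitManinTransportProof`) and T-an-6b (`TwistOrbitAtTwoA1…A4`); split ×4 for the 400-line rule:
1/4 this file · 2/4 `TwistOrbitManinTransportAtTwoExact` (§18: THEOREM A / II / III EXACT at `(−1,2,16)`, `(±2,2,64)`) ·
3/4 `TwistOrbitAtTwoExactDegree` (§19: E-an-22/23/24, commuting orbits exact) · 4/4 `MinusOneTwistLatticeRotationProof`
(§20–§21: E-an-10 / `MinusOneTwistRigidity` reduced, `MinusOneTwistLatticeRotation` PROVED).  PROVED theorems only, no
`sorry`, no conjecture tags; helper lemmas shared with A2/A3 (`cuspCoeff_eq_chi_mul_of_twist_even`,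
`natAbs_LFunction_eq_of_twist_even`, `deg_mul_c_sq_eq_of_twist_even`) are used from the tree (dedup).

WHAT IS NEW (S-an-9, «η = 2 disappears when a₂ = 0»).  g3 proved THEOREM I′ at `2` only up to Stevens'
factor `η = g(χ)/s = 2` (`c′ ∣ 2c ∣ 4c′`, E-an-18), because the `Γ₀` lattice chain uses the FULL Gauss sum
`g(χ)` (`g(χ)² = 4d`) where the Néron lattices differ by `s = g(χ)/2` (`s² = d`).  Here the factor is
removed with NO new analytic input:

* §15 HALF-TRANSLATE.  For `f ∈ S₂(Γ₀(N))`, `4² ∣ N`, with vanishing even coefficients (every newform of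
  an elliptic curve additive at `2`): `{∞, r + ½}_f = −{∞, r}_f` for every rational `r`.  Proof: the tree's
  `χ₋₄`-twist API gives `(f ⊗ χ₄) ⊗ χ₄ = f` (`q`-expansions: `χ₄(n)² aₙ = aₙ` for odd `n`, both sides `0`
  for even `n`), and Birch's lemma `modularSymbol_charTwist` applied twice expresses `{∞, r}_f` through
  `{∞, r}`, `{∞, r + ½}` with coefficient `g(χ₄)⁻² · 2 = −½`; solve.
* §16 EXACT TWIST STEP.  With HALF-TRANSLATE the sum `Σ_u χ(u) {∞, γ(sh u)}_f` in
  `gaussSum_mul_cuspSymbol_charTwist` collapses PAIRWISE (`sh(u + m/2) = sh u + ½`, `χ(u + m/2) = −χ(u)`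
  for the primitive characters mod `4`, `8`), so `(g(χ)/2) · Λ(f ⊗ χ) ⊆ Λ(f)` — Stevens' (5.4) with the
  factor `2` removed (`χ = χ₄, χ₈, χ₈′`).
* §17 the `Γ₀` lattice engine with a general scalar `s` (verbatim the landed
  `maninConstant_dvd_mul_of_charTwist_gamma0` with `g(χ) ↦ s`), the Néron-lattice identification
  `Λ_C = ũ s⁻¹ Λ_W` for `s² = d` (verbatim `neronLattice_mem_iff_of_twist_pStar` with `g(χ) ↦ s`).

Provenance of copied proof text is marked `[verbatim …]`.  Statements, census numbers (BC5) and placement: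
HOME/MEMO-an.md §40–§40c, HOME/CANDIDATES.md rows «S-an-9 + E-an-9/11/12/12c at 2 EXACT», «E-an-22/23/24»,
«E-an-10 REDUCED», «E-an-8 (i) PROVED / (ii) REDUCED».
References: [cite: Stevens1989, Lemma (5.4) p. 97] [cite: Pal2012, Lemma 3.1] [cite: Manin1972, §1.2]
[cite: MontgomeryVaughan2007, Thm. 9.17] [cite: Watkins2002, §2.1] [cite: Cremona1997, §2.8].
-/

noncomputable section

open scoped MatrixGroups ModularForm

open CongruenceSubgroup WeierstrassCurve
  Literature.NumberTheory.DiophantineGeometry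
  Literature.NumberTheory.EllipticCurves
  Literature.NumberTheory.EllipticCurves.ModularForms

namespace Summit.BirchSwinnertonDyer.Rank1Residual.ManinAdditive

section HalfTranslate

/-! ## §15 HALF-TRANSLATE: `{∞, r + ½}_f = −{∞, r}_f` when `4² ∣ N` and the even coefficients vanish -/

/-- `Σ_{u mod 4} χ₄(u) F(u) = F(1) − F(3)`. [elementary] -/
theorem sum_χ₄_mul (F : ZMod 4 → ℂ) :
    ∑ u : ZMod 4, (ZMod.χ₄.ringHomComp (Int.castRingHom ℂ)) u * F u = F 1 - F 3 := by
  show (∑ u : Fin 4, (ZMod.χ₄.ringHomComp (Int.castRingHom ℂ)) u * F u) = F (1 : Fin 4) - F (3 : Fin 4)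
  rw [Fin.sum_univ_four]
  simp only [MulChar.ringHomComp_apply]
  rw [show ZMod.χ₄ (0 : Fin 4) = 0 from rfl, show ZMod.χ₄ (1 : Fin 4) = 1 from rfl,
    show ZMod.χ₄ (2 : Fin 4) = 0 from rfl, show ZMod.χ₄ (3 : Fin 4) = -1 from rfl]
  simp only [map_zero, zero_mul, map_one, one_mul, zero_add, add_zero, map_neg, neg_mul]
  ring

/-- `Σ_{u mod 8} χ₈(u) F(u) = F(1) − F(3) − F(5) + F(7)`. [elementary] -/
theorem sum_χ₈_mul (F : ZMod 8 → ℂ) :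
    ∑ u : ZMod 8, (ZMod.χ₈.ringHomComp (Int.castRingHom ℂ)) u * F u = F 1 - F 3 - F 5 + F 7 := by
  show (∑ u : Fin 8, (ZMod.χ₈.ringHomComp (Int.castRingHom ℂ)) u * F u) =
    F (1 : Fin 8) - F (3 : Fin 8) - F (5 : Fin 8) + F (7 : Fin 8)
  rw [Fin.sum_univ_eight]
  simp only [MulChar.ringHomComp_apply]
  rw [show ZMod.χ₈ (0 : Fin 8) = 0 from rfl, show ZMod.χ₈ (1 : Fin 8) = 1 from rfl,
    show ZMod.χ₈ (2 : Fin 8) = 0 from rfl, show ZMod.χ₈ (3 : Fin 8) = -1 from rfl,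
    show ZMod.χ₈ (4 : Fin 8) = 0 from rfl, show ZMod.χ₈ (5 : Fin 8) = -1 from rfl,
    show ZMod.χ₈ (6 : Fin 8) = 0 from rfl, show ZMod.χ₈ (7 : Fin 8) = 1 from rfl]
  simp only [map_zero, zero_mul, map_one, one_mul, zero_add, add_zero, map_neg, neg_mul]
  ring

/-- `Σ_{u mod 8} χ₈′(u) F(u) = F(1) + F(3) − F(5) − F(7)`. [elementary] -/
theorem sum_χ₈'_mul (F : ZMod 8 → ℂ) :
    ∑ u : ZMod 8, (ZMod.χ₈'.ringHomComp (Int.castRingHom ℂ)) u * F u = F 1 + F 3 - F 5 - F 7 := by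
  show (∑ u : Fin 8, (ZMod.χ₈'.ringHomComp (Int.castRingHom ℂ)) u * F u) =
    F (1 : Fin 8) + F (3 : Fin 8) - F (5 : Fin 8) - F (7 : Fin 8)
  rw [Fin.sum_univ_eight]
  simp only [MulChar.ringHomComp_apply]
  rw [show ZMod.χ₈' (0 : Fin 8) = 0 from rfl, show ZMod.χ₈' (1 : Fin 8) = 1 from rfl,
    show ZMod.χ₈' (2 : Fin 8) = 0 from rfl, show ZMod.χ₈' (3 : Fin 8) = 1 from rfl,
    show ZMod.χ₈' (4 : Fin 8) = 0 from rfl, show ZMod.χ₈' (5 : Fin 8) = -1 from rfl,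
    show ZMod.χ₈' (6 : Fin 8) = 0 from rfl, show ZMod.χ₈' (7 : Fin 8) = -1 from rfl]
  simp only [map_zero, zero_mul, map_one, one_mul, zero_add, add_zero, map_neg, neg_mul]
  ring

/-- `sh 1 = ¼` (mod `4`). [elementary] -/
theorem twistShift_one_four : twistShift (1 : ZMod 4) = 1 / 4 := by
  rw [twistShift, show (1 : ZMod 4).val = 1 from rfl]; norm_num

/-- `sh 3 = ¾` (mod `4`). [elementary] -/
theorem twistShift_three_four : twistShift (3 : ZMod 4) = 3 / 4 := by
  rw [twistShift, show (3 : ZMod 4).val = 3 from rfl]; norm_num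

/-- `sh 1 = ⅛` (mod `8`). [elementary] -/
theorem twistShift_one_eight : twistShift (1 : ZMod 8) = 1 / 8 := by
  rw [twistShift, show (1 : ZMod 8).val = 1 from rfl]; norm_num

/-- `sh 3 = ⅜` (mod `8`). [elementary] -/
theorem twistShift_three_eight : twistShift (3 : ZMod 8) = 3 / 8 := by
  rw [twistShift, show (3 : ZMod 8).val = 3 from rfl]; norm_num

/-- `sh 5 = ⅝` (mod `8`). [elementary] -/
theorem twistShift_five_eight : twistShift (5 : ZMod 8) = 5 / 8 := by
  rw [twistShift, show (5 : ZMod 8).val = 5 from rfl]; norm_num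

/-- `sh 7 = ⅞` (mod `8`). [elementary] -/
theorem twistShift_seven_eight : twistShift (7 : ZMod 8) = 7 / 8 := by
  rw [twistShift, show (7 : ZMod 8).val = 7 from rfl]; norm_num

/-- The linear algebra of the double twist: `G² = −4` and `B = G⁻¹(G⁻¹(A − B) − G⁻¹(B − A))` force
`A = −B`. [elementary] -/
theorem eq_neg_of_double_twist {G A B : ℂ} (hG2 : G ^ 2 = -4)
    (E : B = G⁻¹ * (G⁻¹ * (A - B) - G⁻¹ * (B - A))) : A = -B := by
  have hG0 : G ≠ 0 := by
    rintro rfl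
    norm_num at hG2
  have h1 : G * G⁻¹ = 1 := mul_inv_cancel₀ hG0
  have E2 : G ^ 2 * (G⁻¹ * (G⁻¹ * (A - B) - G⁻¹ * (B - A))) = 2 * (A - B) := by
    linear_combination (2 * (A - B)) * (G * G⁻¹ + 1) * h1
  rw [← E] at E2
  linear_combination (-1 / 2 : ℂ) * E2 + (B / 2) * hG2

/-- **S-an-9a HALF-TRANSLATE.** For `f ∈ S₂(Γ₀(N))` with `4² ∣ N` whose even `q`-expansion coefficients
vanish, `{∞, r + ½}_f = −{∞, r}_f` for every rational `r`.  Proof WITHOUT analysis: `(f ⊗ χ₄) ⊗ χ₄ = f`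
(coefficientwise), and Birch's lemma `modularSymbol_charTwist` twice gives
`{∞,r}_f = g⁻²(2{∞, r+½}_f − 2{∞, r}_f)` with `g² = g(χ₄)² = −4`. [cite: Manin1972, §1.2]
[cite: Cremona1997, §2.8] [cite: MontgomeryVaughan2007, Thm. 9.17] -/
theorem modularSymbol_add_half_eq_neg {N : ℕ} [NeZero N] (f : CuspForm (Gamma0 N) 2)
    (h16 : 4 ^ 2 ∣ N) (heven : ∀ n : ℕ, 2 ∣ n → cuspCoeff f n = 0) (r : ℚ) :
    modularSymbol f (r + 1 / 2) = -modularSymbol f r := by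
  have hχ : (ZMod.χ₄.ringHomComp (Int.castRingHom ℂ)).IsQuadratic := isQuadratic_χ₄_ringHomComp
  have hprim : DirichletCharacter.IsPrimitive (ZMod.χ₄.ringHomComp (Int.castRingHom ℂ)) :=
    isPrimitive_χ₄_ringHomComp
  have hNN : N ∣ N := dvd_rfl
  have hχχ : ∀ n : ℕ, (ZMod.χ₄.ringHomComp (Int.castRingHom ℂ)) n *
      ((ZMod.χ₄.ringHomComp (Int.castRingHom ℂ)) n * cuspCoeff f n) = cuspCoeff f n := by
    intro n
    by_cases h2 : 2 ∣ n
    · rw [heven n h2, mul_zero, mul_zero]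
    · rw [← mul_assoc, χ₄_ringHomComp_apply_natCast, ZMod.χ₄_nat_eq_if_mod_four,
        if_neg (fun h ↦ h2 (Nat.dvd_of_mod_eq_zero h))]
      split_ifs <;> push_cast <;> ring
  have hgg : charTwist N hNN h16 hχ (charTwist N hNN h16 hχ f) = f :=
    eq_of_forall_cuspCoeff_eq_gamma0 fun n ↦ by
      rw [cuspCoeff_charTwist N hNN h16 hχ hprim, cuspCoeff_charTwist N hNN h16 hχ hprim, hχχ]
  have hp0 : modularSymbol f (r + 1 / 4 + 1 / 4) = modularSymbol f (r + 1 / 2) := by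
    rw [show r + 1 / 4 + 1 / 4 = r + 1 / 2 by ring]
  have hp1 : modularSymbol f (r + 1 / 4 + 3 / 4) = modularSymbol f r := by
    rw [show r + 1 / 4 + 3 / 4 = r + ((1 : ℤ) : ℚ) by push_cast; ring]
    exact modularSymbol_add_intCast_holds f r 1
  have hp2 : modularSymbol f (r + 3 / 4 + 1 / 4) = modularSymbol f r := by
    rw [show r + 3 / 4 + 1 / 4 = r + ((1 : ℤ) : ℚ) by push_cast; ring]
    exact modularSymbol_add_intCast_holds f r 1
  have hp3 : modularSymbol f (r + 3 / 4 + 3 / 4) = modularSymbol f (r + 1 / 2) := by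
    rw [show r + 3 / 4 + 3 / 4 = r + 1 / 2 + ((1 : ℤ) : ℚ) by push_cast; ring]
    exact modularSymbol_add_intCast_holds f (r + 1 / 2) 1
  have key := modularSymbol_charTwist N hNN h16 hχ (charTwist N hNN h16 hχ f) r
  rw [hgg, sum_χ₄_mul, twistShift_one_four, twistShift_three_four,
    modularSymbol_charTwist N hNN h16 hχ f, modularSymbol_charTwist N hNN h16 hχ f,
    sum_χ₄_mul, sum_χ₄_mul, twistShift_one_four, twistShift_three_four, hp0, hp1, hp2, hp3] at key
  exact eq_neg_of_double_twist gaussSum_χ₄_ringHomComp_sq key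

end HalfTranslate

section ExactTwistStep

/-! ## §16 THE EXACT TWIST STEP `(g(χ)/2) · Λ(f ⊗ χ) ⊆ Λ(f)` (S-an-9) -/

/-- **S-an-9 (abstract form).** If for every rational `x` the character sum of Birch's lemma collapses to
`2({∞, x + sh u₁}_f + ε {∞, x + sh u₂}_f)` (`ε ∈ ℤ`), then `(g(χ)/2) · Λ(f ⊗ χ) ⊆ Λ(f)` — Stevens'
Lemma (5.4) on `Γ₀` with his factor `η = 2` removed.  Proof: verbatim the tree's
`gaussSum_mul_mem_periodLattice_of_mem_charTwist` (closure induction over the `Γ₀(L)`-cusp symbols of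
`f ⊗ χ`, `gaussSum_mul_cuspSymbol_charTwist`, `exists_modularSymbol_add_twistShift_eq_cuspSymbol`), the
two surviving symbols being `Γ₀(N)`-cusp symbols of `f`. [cite: Stevens1989, Lemma (5.4) p. 97]
[cite: Cremona1997, §2.8] -/
theorem half_gaussSum_mul_mem_periodLattice_of_mem_charTwist {N : ℕ} [NeZero N] {m : ℕ} [NeZero m]
    (L : ℕ) [NeZero L] (hN : N ∣ L) (hm : m ^ 2 ∣ L)
    {χ : DirichletCharacter ℂ m} (hχ : χ.IsQuadratic) (hprim : χ.IsPrimitive)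
    (f : CuspForm (Gamma0 N) 2)
    (hsum : ∀ x : ℚ, ∃ (u₁ u₂ : ZMod m) (ε : ℤ),
      ∑ u : ZMod m, χ u * modularSymbol f (x + twistShift u) =
        2 * (modularSymbol f (x + twistShift u₁) + ε * modularSymbol f (x + twistShift u₂)))
    {z : ℂ} (hz : z ∈ periodLattice (charTwist L hN hm hχ f)) :
    gaussSum χ (ZMod.stdAddChar (N := m)) / 2 * z ∈ periodLattice f := by
  induction hz using AddSubgroup.closure_induction with
  | mem x hx =>
    obtain ⟨γ, rfl⟩ := hx
    by_cases hc0 : (γ : SL(2, ℤ)) 1 0 = 0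
    · rw [cuspSymbol, if_pos hc0, mul_zero]
      exact zero_mem _
    obtain ⟨u₁, u₂, ε, hε⟩ :=
      hsum ((((γ : SL(2, ℤ)) 0 0 : ℤ) : ℚ) / (((γ : SL(2, ℤ)) 1 0 : ℤ) : ℚ))
    obtain ⟨γ₁, hγ₁, -, -, h₁⟩ :=
      exists_modularSymbol_add_twistShift_eq_cuspSymbol L hN hm f γ hc0 u₁
    obtain ⟨γ₂, hγ₂, -, -, h₂⟩ :=
      exists_modularSymbol_add_twistShift_eq_cuspSymbol L hN hm f γ hc0 u₂
    have key : gaussSum χ (ZMod.stdAddChar (N := m)) / 2 * cuspSymbol (charTwist L hN hm hχ f) γ =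
        cuspSymbol f ⟨γ₁, hγ₁⟩ + (ε : ℂ) * cuspSymbol f ⟨γ₂, hγ₂⟩ := by
      rw [div_mul_eq_mul_div, gaussSum_mul_cuspSymbol_charTwist L hN hm hχ hprim f γ hc0, hε, h₁, h₂]
      ring
    rw [key]
    refine add_mem (cuspSymbol_mem_periodLattice f _) ?_
    rw [← zsmul_eq_mul]
    exact AddSubgroup.zsmul_mem _ (cuspSymbol_mem_periodLattice f _) ε
  | zero =>
    rw [mul_zero]
    exact zero_mem _
  | add x y _ _ hx hy =>
    rw [mul_add]
    exact add_mem hx hy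
  | neg x _ hx =>
    rw [mul_neg]
    exact neg_mem hx

/-- The `χ₄` character sum under HALF-TRANSLATE: `Σ_u χ₄(u){∞, x + sh u} = 2{∞, x + ¼}` (`sh 3 = sh 1 + ½`).
[elementary] -/
theorem sum_χ₄_modularSymbol_of_half {N : ℕ} [NeZero N] (f : CuspForm (Gamma0 N) 2)
    (hhalf : ∀ x : ℚ, modularSymbol f (x + 1 / 2) = -modularSymbol f x) (x : ℚ) :
    ∑ u : ZMod 4, (ZMod.χ₄.ringHomComp (Int.castRingHom ℂ)) u * modularSymbol f (x + twistShift u) =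
      2 * (modularSymbol f (x + twistShift (1 : ZMod 4)) +
        ((0 : ℤ) : ℂ) * modularSymbol f (x + twistShift (3 : ZMod 4))) := by
  rw [sum_χ₄_mul, twistShift_three_four, twistShift_one_four,
    show x + 3 / 4 = x + 1 / 4 + 1 / 2 by ring, hhalf]
  push_cast
  ring

/-- The `χ₈` character sum under HALF-TRANSLATE: `Σ_u χ₈(u){∞, x + sh u} = 2({∞, x+⅛} − {∞, x+⅜})`
(`sh 5 = sh 1 + ½`, `sh 7 = sh 3 + ½`, `χ₈(5) = −χ₈(1)`, `χ₈(7) = −χ₈(3)`). [elementary] -/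
theorem sum_χ₈_modularSymbol_of_half {N : ℕ} [NeZero N] (f : CuspForm (Gamma0 N) 2)
    (hhalf : ∀ x : ℚ, modularSymbol f (x + 1 / 2) = -modularSymbol f x) (x : ℚ) :
    ∑ u : ZMod 8, (ZMod.χ₈.ringHomComp (Int.castRingHom ℂ)) u * modularSymbol f (x + twistShift u) =
      2 * (modularSymbol f (x + twistShift (1 : ZMod 8)) +
        ((-1 : ℤ) : ℂ) * modularSymbol f (x + twistShift (3 : ZMod 8))) := by
  rw [sum_χ₈_mul, twistShift_five_eight, twistShift_seven_eight, twistShift_one_eight,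
    twistShift_three_eight, show x + 5 / 8 = x + 1 / 8 + 1 / 2 by ring,
    show x + 7 / 8 = x + 3 / 8 + 1 / 2 by ring, hhalf, hhalf]
  push_cast
  ring

/-- The `χ₈′` character sum under HALF-TRANSLATE: `Σ_u χ₈′(u){∞, x + sh u} = 2({∞, x+⅛} + {∞, x+⅜})`.
[elementary] -/
theorem sum_χ₈'_modularSymbol_of_half {N : ℕ} [NeZero N] (f : CuspForm (Gamma0 N) 2)
    (hhalf : ∀ x : ℚ, modularSymbol f (x + 1 / 2) = -modularSymbol f x) (x : ℚ) :
    ∑ u : ZMod 8, (ZMod.χ₈'.ringHomComp (Int.castRingHom ℂ)) u * modularSymbol f (x + twistShift u) =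
      2 * (modularSymbol f (x + twistShift (1 : ZMod 8)) +
        ((1 : ℤ) : ℂ) * modularSymbol f (x + twistShift (3 : ZMod 8))) := by
  rw [sum_χ₈'_mul, twistShift_five_eight, twistShift_seven_eight, twistShift_one_eight,
    twistShift_three_eight, show x + 5 / 8 = x + 1 / 8 + 1 / 2 by ring,
    show x + 7 / 8 = x + 3 / 8 + 1 / 2 by ring, hhalf, hhalf]
  push_cast
  ring

end ExactTwistStep

section Engine

/-! ## §17 The `Γ₀` lattice engine with a general scalar `s`, and the Néron lattice of the partner -/

/-- **Néron lattice of the partner, general scalar.** If `C = u • (W ⊗ χ_d)`, `r¹²Δ(C) = d⁶Δ(W)`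
(`r = ũ ∈ {1, q}`) and `s² = d`, then `u = ±r` and `Λ_C = ± r s⁻¹ Λ_W`:
`z ∈ Λ_C ⟺ s r⁻¹ z ∈ Λ_W`.  [verbatim the landed `neronLattice_mem_iff_of_twist_pStar` with `g(χ) ↦ s`]
[cite: Pal2012, Lemma 3.1] [cite: SilvermanATAEC1994, Cor. IV.9.1] -/
theorem neronLattice_mem_iff_of_twist_of_sq_eq {W C : WeierstrassCurve ℚ} [W.IsElliptic]
    {d : ℚ} (hd : d ≠ 0) (u : VariableChange ℚ) (hu : u • W.quadraticTwist d = C) {r : ℚ}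
    (hΔ : r ^ 12 * C.Δ = d ^ 6 * W.Δ) {s : ℂ} (hs : s ^ 2 = (d : ℂ))
    {L LC : PeriodPair} (hL : IsNeronLatticeOf (W.baseChange ℂ) L)
    (hLC : IsNeronLatticeOf (C.baseChange ℂ) LC) (z : ℂ) :
    z ∈ LC.lattice ↔ s * ((((r : ℚ)) : ℂ)⁻¹ * z) ∈ L.lattice := by
  have hd0 : (d : ℂ) ≠ 0 := by exact_mod_cast hd
  have hs0 : s ≠ 0 := fun h0 ↦ hd0 (by rw [← hs, h0]; simp)
  have hLT : IsNeronLatticeOf ((W.quadraticTwist d).baseChange ℂ) (L.mulLeft s⁻¹ (inv_ne_zero hs0)) :=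
    WeierstrassCurve.isNeronLatticeOf_quadraticTwist_of_sq_eq d hL hs0 hs
  have hLC' : IsNeronLatticeOf ((u • W.quadraticTwist d).baseChange ℂ) LC := by rw [hu]; exact hLC
  have hlat := IsNeronLatticeOf.lattice_eq_mulLeft_of_smul u hLT hLC'
  have hu2 : ((u.u : ℚ)) ^ 2 = r ^ 2 := u_sq_eq_sq_of_smul_quadraticTwist_of_Δ hd u hu hΔ
  have hU : (u.u : ℚ) = r ∨ (u.u : ℚ) = -r := sq_eq_sq_iff_eq_or_eq_neg.mp hu2
  rw [hlat, PeriodPair.mem_mulLeft_lattice, PeriodPair.mem_mulLeft_lattice, inv_inv]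
  rcases hU with h1 | h1
  · rw [h1]
  · rw [h1, Rat.cast_neg, inv_neg, show s * (-((r : ℚ) : ℂ)⁻¹ * z) = -(s * ((((r : ℚ) : ℂ))⁻¹ * z))
      by ring, neg_mem_iff]

/-- The same relation read backwards: `aₙ(f_W) = χ(n) aₙ(f_{W′})` (`χ(n)² = 1` for odd `n`; even `n`:
both sides vanish, `W` additive at `2` too). [cite: Stevens1989, (5.5) p. 97] -/
theorem cuspCoeff_eq_chi_mul_of_twist_even' {W W' C : WeierstrassCurve ℚ} [W.IsElliptic] [W'.IsElliptic]
    {N N' : ℕ} [NeZero N] [NeZero N'] {d : ℚ} (hd : d ≠ 0) {m : ℕ} {χ : DirichletCharacter ℂ m}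
    (u : VariableChange ℚ) (hu : u • W.quadraticTwist d = C) (hLC : C.LFunction = W'.LFunction)
    (hodd : ∀ n : ℕ, ¬ 2 ∣ n → (((W.quadraticTwist d).LFunction n : ℤ) : ℂ) = χ n * (W.LFunction n : ℂ))
    (hsq : ∀ n : ℕ, ¬ 2 ∣ n → χ n * χ n = 1) (heven : ∀ n : ℕ, 2 ∣ n → χ n = 0)
    (hW0 : ∀ n : ℕ, 2 ∣ n → W.LFunction n = 0)
    (D : ModularParametrizationData W N) (D' : ModularParametrizationData W' N') (n : ℕ) :
    cuspCoeff D.f n = χ n * cuspCoeff D'.f n := by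
  haveI := W.isElliptic_quadraticTwist hd
  rw [D'.isNewformOf.2 n, D.isNewformOf.2 n]
  by_cases h2 : 2 ∣ n
  · rw [hW0 n h2, heven n h2]
    simp
  · rw [← hLC, ← hu, LFunction_smul, hodd n h2, ← mul_assoc, hsq n h2, one_mul]

/-- **The `Γ₀` lattice chain with a general scalar `s` and an integer factor `r`: `c(D) ∣ r · c(D′)`.**
Verbatim the landed `maninConstant_dvd_mul_of_charTwist_gamma0` with the Gauss sum replaced by any
scalar `s` such that `s · Λ(f_{D′} ⊗ χ) ⊆ Λ(f_{D′})` (`hstep`; at `2`, `s = g(χ)/2` by §16):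
`z = c w ∈ Λ_W`, `s w ∈ Λ(f_{D′})`, `c′ s w ∈ Λ_A` ⟹ `r c′ w ∈ Λ_C`, so `(r c′/c) Λ_W ⊆ Λ_C` and
`r c′/c ∈ ℤ` (Néron mapping property). [cite: Stevens1989, Lemma (5.4) p. 97 and (2.8) p. 88]
[cite: SilvermanATAEC1994, IV.5.1 with IV.6.1 and Cor. IV.9.1] -/
theorem maninConstant_dvd_mul_of_twistStep {A : WeierstrassCurve ℚ} {N' : ℕ} [NeZero N']
    {W : WeierstrassCurve ℚ} [W.IsElliptic] [W.IsGloballyMinimal] {N : ℕ} [NeZero N]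
    {m : ℕ} [NeZero m] {χ : DirichletCharacter ℂ m}
    {C : WeierstrassCurve ℚ} [C.IsElliptic] [C.IsGloballyMinimal] {LC : PeriodPair}
    (D' : ModularParametrizationData A N') (D : ModularParametrizationData W N)
    (h : ∀ z ∈ D.L.lattice, ∃ w ∈ periodLattice D.f, z = D.c * w)
    (hχ : χ.IsQuadratic) (hprim : χ.IsPrimitive) (hN : N' ∣ N) (hm : m ^ 2 ∣ N)
    (hf : ∀ n : ℕ, cuspCoeff D.f n = χ n * cuspCoeff D'.f n) (s : ℂ)
    (hstep : ∀ w ∈ periodLattice (charTwist N hN hm hχ D'.f), s * w ∈ periodLattice D'.f)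
    (hC : IsNeronLatticeOf (C.baseChange ℂ) LC) (r : ℤ)
    (hLC : ∀ z : ℂ, s * z ∈ D'.L.lattice → (r : ℂ) * z ∈ LC.lattice) :
    D.c ∣ r * D'.c := by
  have hfeq : D.f = charTwist N hN hm hχ D'.f :=
    eq_of_forall_cuspCoeff_eq_gamma0 fun n ↦ by rw [hf, cuspCoeff_charTwist N hN hm hχ hprim]
  have hc : D.c ≠ 0 := D.maninConstant_ne_zero_holds
  have key : ∀ z ∈ D.L.lattice, ((((r * D'.c : ℚ) / D.c : ℚ)) : ℂ) * z ∈ LC.lattice := by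
    intro z hz
    obtain ⟨w, hw, rfl⟩ := h z hz
    have hw' : s * w ∈ periodLattice D'.f := by
      rw [hfeq] at hw
      exact hstep w hw
    have h3 : (D'.c : ℂ) * (s * w) ∈ D'.L.lattice := D'.smul_periodLattice_le _ hw'
    have h4 : (r : ℂ) * ((D'.c : ℂ) * w) ∈ LC.lattice :=
      hLC _ (by rw [show s * ((D'.c : ℂ) * w) = (D'.c : ℂ) * (s * w) by ring]; exact h3)
    have hcℂ : (D.c : ℂ) ≠ 0 := by exact_mod_cast hc
    convert h4 using 1
    push_cast
    field_simp
  obtain ⟨k, hk⟩ :=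
    integral_neronScaling_of_isGloballyMinimal_holds W C D.L LC D.isNeronLattice hC _ key
  have hcℚ : (D.c : ℚ) ≠ 0 := by exact_mod_cast hc
  have h' : ((r : ℚ) * D'.c : ℚ) = D.c * k := by
    rw [hk]
    field_simp
  exact ⟨k, by exact_mod_cast h'⟩

end Engine

end Summit.BirchSwinnertonDyer.Rank1Residual.ManinAdditive
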